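import Summits.BirchSwinnertonDyer.BirchSwinnertonDyer.Theses.UniversalToricDescent
import Summits.BirchSwinnertonDyer.BirchSwinnertonDyer.Theorems.UniversalToricDescentTwinSplitIMCAtThreeOfThreeFrames
import Summits.BirchSwinnertonDyer.BirchSwinnertonDyer.Theorems.UniversalToricDescentSelfMuZeroAtThree
import HarnessLib

/-!
# Route `UniversalToricDescent`: child crux `TwinSplitIMCAtThreeMult` (item stmt-BirchSwinnertonDyer-20694, bucket B =
# 675/2 023 twin classes, 3 ∥ N′) BY NAME from TWO research frames and ONE refereed fact — the `μ`-stub of line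
# `threeframes` is Hsieh 2014 Thm. B (any level) BY NAME given ANY frame

Lead prover `bsd-wall-utd-p2` g4 (LINE mode; 20694 is the seat's second item; skeleton `threeframes` sha16
a2641b3bc9bf3dbf: stubs `stub_howardFrameMult` / `stub_wanFrameMult` / `stub_muFrameMult`). The line card prices
`stub_muFrameMult` as «conjunct (i) in R₀-currency at 3 ∥ N′ (unprinted) + Hsieh Thm B by name». THIS FILE proves:
* §1 `exists_isUnit_coeff_of_isBDPLFunction_of_thmB` — for ANY `W/ℚ` with `ρ̄_{W,3}` onto (NO reduction type at 3),
  `K` imaginary quadratic Heegner for `N`, `3 = 𝔭𝔭′` split (`𝔭` of degree one), `κ` anticyclotomic, `ι′` inducing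
  `𝔭`: EVERY `R₀`-frame `L` of `f_W` at `(ι′, 𝔭)` with non-zero periods has a UNIT coefficient (`μ(L) = 0`) —
  CONDITIONAL only on the refereed fact `Hsieh2014.thmB_exists_isHsiehLFunction_coeff_norm_eq_one_unrPeriod_anyLevel`
  (utd-p1 g4's `self_exists_isBDPLFunctionInt_coeff_norm_eq_one` p548594 ∘ the ♭ `μ`-transfer
  `exists_coeff_norm_eq_one_of_isBDPLFunctionInt_of_isBDPLFunction` p538896 ∘ `unrIntegers.isUnit_iff_norm_eq_one`).
  Hence `stub_muFrameMult ⟸ stub_howardFrameMult ∧ hB` (a Howard frame IS a frame): the line's `μ`-stub carries NO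
  research content beyond the Howard stub.
* §2 `twinSplitIMCAtThreeMult_of_howardFrame_of_wanFrame_of_thmB` — the ROUTE DECL `TwinSplitIMCAtThreeMult`
  from exactly {`hHow` = ∀-closure of `stub_howardFrameMult` (research: Howard direction at a MULTIPLICATIVE 3, no
  print — Howard 2004 `p ∤ N`, Castella 2018 §4 `p ≥ 5`, no admissible primes at 3), `hWan` = ∀-closure of
  `stub_wanFrameMult` (research: rational Wan direction at 3 ∥ N′ under `N⁻ = 1`), `hB` (refereed)} — one `exact`
  over `twinSplit_instance_of_three_frames` (p543791). The glue of a prospective gen-2 split of 20694 into two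
  research children + one by-name child. CONDITIONAL result; closes nothing. Beyond-print BSD theorem: NO.
`--supports stmt-BirchSwinnertonDyer-20694 --as helper`.

References: [Hsieh2014] Thm. B (Doc. Math. 19 (2014) p. 712 = arXiv:1112.1580 Thm. 2); [Castella2018] Thm. 3.1
(frame normalisation) and §4 (`p ≥ 5`); [Howard2004HeegnerKolyvagin] Thm. B (`p ∤ N`); memo
HOME/bsd-wall/bsd-wall-utd-p2/SUPSET-AT3-v6.md §2/§7.
-/

noncomputable section

open scoped Classical

set_option linter.dupNamespace false
set_option autoImplicit false

namespace Summit.BirchSwinnertonDyer.BirchSwinnertonDyer.Theorems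

open PowerSeries WeierstrassCurve NumberField IsDedekindDomain Field
  Literature.NumberTheory.EllipticCurves
  Literature.NumberTheory.EllipticCurves.ModularForms
  Literature.NumberTheory.EllipticCurves.Rank1Residual
  Summit.BirchSwinnertonDyer.Rank1Residual.X11b
  Summit.BirchSwinnertonDyer.Rank1Residual.X11b.Halves
  Summit.BirchSwinnertonDyer.BirchSwinnertonDyer.Theorems.SchneiderFree

/-! ### §1 Every `R₀`-frame has `μ = 0`, at ANY reduction type, from Hsieh 2014 Thm. B (any level) -/

/-- **Every BDP `R₀`-frame of `f_W` has a unit coefficient, whatever the reduction of `W` at `3`.** For `W/ℚ` with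
`ρ̄_{W,3}` onto, `K` imaginary quadratic with the Heegner hypothesis for `N`, `𝔭 ∋ 3` of degree one, `κ`
anticyclotomic with topological generator `γ`, `ι′` inducing `𝔭`, and ANY frame `(Ω_K ≠ 0, Ω_p ≠ 0, L)` with
`IsBDPLFunction ι′ 𝔭 κ γ f_W Ω_K Ω_p L`: some coefficient of `L ∈ R₀⟦T⟧` is a unit (`μ(L) = 0`). Hsieh's ♭-witness
(utd-p1 `self_exists_isBDPLFunctionInt_coeff_norm_eq_one`) is moved to `L` by the ♭ `μ`-transfer across periods
and read through `IsUnit x ↔ ‖x‖ = 1` in `R₀`. CONDITIONAL on the refereed named fact `hB` only.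
[cite: Hsieh2014, Thm. B p. 712 (Doc. Math. 19)] [cite: Castella2018, Thm. 3.1 (arXiv:1704.06608 p. 9)] -/
theorem exists_isUnit_coeff_of_isBDPLFunction_of_thmB
    (hB : Hsieh2014.thmB_exists_isHsiehLFunction_coeff_norm_eq_one_unrPeriod_anyLevel)
    (W : WeierstrassCurve ℚ) [W.IsElliptic] (N : ℕ) [NeZero N]
    (K : Type) [Field K] [NumberField K] (Dt : ModularParametrizationData W N)
    (honto : W.HasSurjectiveModNGaloisRep 3) (hK : IsImaginaryQuadratic K)
    (hH : SatisfiesHeegnerHypothesis N K) (κ : ZpExtension K 3) (hκ : κ.IsAnticyclotomic)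
    (γ : absoluteGaloisGroup K) [Fact (κ.IsTopGenerator γ)]
    (𝔭 : HeightOneSpectrum (𝓞 K)) (h𝔭 : ((3 : ℕ) : 𝓞 K) ∈ 𝔭.asIdeal)
    (he : 𝔭.asIdeal.ramificationIdx (𝓞 ℚ) = 1) (hf : 𝔭.asIdeal.inertiaDeg (𝓞 ℚ) = 1)
    (ι' : PadicAlgCl 3 ≃+* ℂ) (hι' : BranchInducesPrime 3 ι' 𝔭)
    {ΩK : ℂ} {Ωp : ℂ_[3]} {L : UnrSeries 3} (hΩK : ΩK ≠ 0) (hΩp : Ωp ≠ 0)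
    (hL : IsBDPLFunction ι' 𝔭 κ γ Dt.f ΩK Ωp L) :
    ∃ i : ℕ, IsUnit (PowerSeries.coeff i L) := by
  obtain ⟨ΩK₁, Ωp₁, Q, hΩK₁, hΩp₁, hQ, hμQ⟩ :=
    UniversalToricDescentSelfMuZero.self_exists_isBDPLFunctionInt_coeff_norm_eq_one hB W N K Dt honto hK hH κ
      hκ γ 𝔭 h𝔭 he hf ι' hι'
  have hΩp₁0 : Ωp₁ ≠ 0 := fun h ↦ by rw [h, norm_zero] at hΩp₁; exact zero_ne_one hΩp₁
  obtain ⟨i, hi⟩ :=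
    UniversalToricDescentFlatMuTransfer.exists_coeff_norm_eq_one_of_isBDPLFunctionInt_of_isBDPLFunction hK hκ
      Fact.out hΩK₁ hΩK hΩp₁0 hΩp hQ hL hμQ
  exact ⟨i, (unrIntegers.isUnit_iff_norm_eq_one _).mpr hi⟩

/-- **A frame is a `μ = 0` frame** (the `μ`-stub of line `threeframes` from ANY frame, by Hsieh Thm. B): if SOME
frame `(Ω_K ≠ 0, Ω_p ≠ 0, L)` of `f_W` at `(ι′, 𝔭)` exists then some frame has a unit coefficient — namely the same
one. CONDITIONAL on `hB` only; no reduction type at `3`. [cite: Hsieh2014, Thm. B p. 712 (Doc. Math. 19)] -/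
theorem exists_muFrame_of_exists_frame_of_thmB
    (hB : Hsieh2014.thmB_exists_isHsiehLFunction_coeff_norm_eq_one_unrPeriod_anyLevel)
    (W : WeierstrassCurve ℚ) [W.IsElliptic] (N : ℕ) [NeZero N]
    (K : Type) [Field K] [NumberField K] (Dt : ModularParametrizationData W N)
    (honto : W.HasSurjectiveModNGaloisRep 3) (hK : IsImaginaryQuadratic K)
    (hH : SatisfiesHeegnerHypothesis N K) (κ : ZpExtension K 3) (hκ : κ.IsAnticyclotomic)
    (γ : absoluteGaloisGroup K) [Fact (κ.IsTopGenerator γ)]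
    (𝔭 : HeightOneSpectrum (𝓞 K)) (h𝔭 : ((3 : ℕ) : 𝓞 K) ∈ 𝔭.asIdeal)
    (he : 𝔭.asIdeal.ramificationIdx (𝓞 ℚ) = 1) (hf : 𝔭.asIdeal.inertiaDeg (𝓞 ℚ) = 1)
    (ι' : PadicAlgCl 3 ≃+* ℂ) (hι' : BranchInducesPrime 3 ι' 𝔭)
    (hFr : ∃ (ΩK : ℂ) (Ωp : ℂ_[3]) (L : UnrSeries 3), ΩK ≠ 0 ∧ Ωp ≠ 0 ∧
      IsBDPLFunction ι' 𝔭 κ γ Dt.f ΩK Ωp L) :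
    ∃ (ΩK : ℂ) (Ωp : ℂ_[3]) (L : UnrSeries 3), ΩK ≠ 0 ∧ Ωp ≠ 0 ∧
      IsBDPLFunction ι' 𝔭 κ γ Dt.f ΩK Ωp L ∧ ∃ i : ℕ, IsUnit (PowerSeries.coeff i L) := by
  obtain ⟨ΩK, Ωp, L, hΩK, hΩp, hL⟩ := hFr
  exact ⟨ΩK, Ωp, L, hΩK, hΩp, hL, exists_isUnit_coeff_of_isBDPLFunction_of_thmB hB W N K Dt honto hK hH κ hκ γ
    𝔭 h𝔭 he hf ι' hι' hΩK hΩp hL⟩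

/-! ### §2 Bucket B by name from {Howard frame (research), Wan frame (research), Hsieh Thm. B (refereed)} -/

/-- **Child crux `TwinSplitIMCAtThreeMult` (20694) from two research frames and Hsieh Thm. B.** If `hHow` (at
every datum of the child, a BDP frame `L` of `f_{W′}` at `(ι′, 𝔭)` with `L ∈ Ch_Λ(X_ac(W′_K) strict at 𝔭′)·R₀⟦T⟧` —
the Howard direction at a MULTIPLICATIVE `3`, no print), `hWan` (at every datum, a frame `L` with
`3^k · Ch·R₀⟦T⟧ ⊆ (L)` — the rational Wan direction at `3 ∥ N′` under `N⁻ = 1`, no print) and the refereed fact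
`hB` (Hsieh 2014 Thm. B at every level) hold, then the route decl `TwinSplitIMCAtThreeMult` holds: (i) and the
every-frame equality (ii) at every multiplicative-at-3 twin with `ρ̄₃` onto, every Heegner `K` with `3` split and
`d_K` odd. The `μ`-frame is the Howard frame itself (§1). One `exact` over `twinSplit_instance_of_three_frames`.
CONDITIONAL on `hHow`, `hWan` (research) and `hB` (refereed). [cite: Hsieh2014, Thm. B p. 712 (Doc. Math. 19)]
[cite: Castella2018, Thm. 3.1 and §4 (arXiv:1704.06608)] -/
theorem twinSplitIMCAtThreeMult_of_howardFrame_of_wanFrame_of_thmB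
    (hB : Hsieh2014.thmB_exists_isHsiehLFunction_coeff_norm_eq_one_unrPeriod_anyLevel)
    (hHow :
    ∀ (W' : WeierstrassCurve ℚ) [W'.IsElliptic] [W'.IsGloballyMinimal] (N' : ℕ) [NeZero N']
      (K : Type) [Field K] [NumberField K] (Dt' : ModularParametrizationData W' N'),
      Mult W' 3 → W'.HasSurjectiveModNGaloisRep 3 → W'.conductorNorm ℤ = N' → IsImaginaryQuadratic K →
      SatisfiesHeegnerHypothesis N' K → Odd (NumberField.discr K) →
      ∀ (κ : ZpExtension K 3), κ.IsAnticyclotomic → ∀ (γ : absoluteGaloisGroup K) [Fact (κ.IsTopGenerator γ)]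
        (𝔭 : HeightOneSpectrum (𝓞 K)), ((3 : ℕ) : 𝓞 K) ∈ 𝔭.asIdeal →
        𝔭.asIdeal.ramificationIdx (𝓞 ℚ) = 1 → 𝔭.asIdeal.inertiaDeg (𝓞 ℚ) = 1 →
        ∀ (𝔭' : HeightOneSpectrum (𝓞 K)), ((3 : ℕ) : 𝓞 K) ∈ 𝔭'.asIdeal → 𝔭' ≠ 𝔭 →
        ∀ (ι' : PadicAlgCl 3 ≃+* ℂ), BranchInducesPrime 3 ι' 𝔭 →
        ∃ (ΩK : ℂ) (Ωp : ℂ_[3]) (L : UnrSeries 3), ΩK ≠ 0 ∧ Ωp ≠ 0 ∧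
          IsBDPLFunction ι' 𝔭 κ γ Dt'.f ΩK Ωp L ∧
          L ∈ (AcSelmer.XAc.charIdeal (W'.baseChange K) 3 κ 𝔭' ∅ γ).map (PowerSeries.map (toUnr 3)))
    (hWan :
    ∀ (W' : WeierstrassCurve ℚ) [W'.IsElliptic] [W'.IsGloballyMinimal] (N' : ℕ) [NeZero N']
      (K : Type) [Field K] [NumberField K] (Dt' : ModularParametrizationData W' N'),
      Mult W' 3 → W'.HasSurjectiveModNGaloisRep 3 → W'.conductorNorm ℤ = N' → IsImaginaryQuadratic K →
      SatisfiesHeegnerHypothesis N' K → Odd (NumberField.discr K) →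
      ∀ (κ : ZpExtension K 3), κ.IsAnticyclotomic → ∀ (γ : absoluteGaloisGroup K) [Fact (κ.IsTopGenerator γ)]
        (𝔭 : HeightOneSpectrum (𝓞 K)), ((3 : ℕ) : 𝓞 K) ∈ 𝔭.asIdeal →
        𝔭.asIdeal.ramificationIdx (𝓞 ℚ) = 1 → 𝔭.asIdeal.inertiaDeg (𝓞 ℚ) = 1 →
        ∀ (𝔭' : HeightOneSpectrum (𝓞 K)), ((3 : ℕ) : 𝓞 K) ∈ 𝔭'.asIdeal → 𝔭' ≠ 𝔭 →
        ∀ (ι' : PadicAlgCl 3 ≃+* ℂ), BranchInducesPrime 3 ι' 𝔭 →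
        ∃ (ΩK : ℂ) (Ωp : ℂ_[3]) (L : UnrSeries 3), ΩK ≠ 0 ∧ Ωp ≠ 0 ∧
          IsBDPLFunction ι' 𝔭 κ γ Dt'.f ΩK Ωp L ∧
          ∃ k : ℕ, ∀ G ∈ (AcSelmer.XAc.charIdeal (W'.baseChange K) 3 κ 𝔭' ∅ γ).map
            (PowerSeries.map (toUnr 3)), PowerSeries.C (((3 : ℕ) : unrIntegers 3) ^ k) * G ∈ Ideal.span {L}) :
    Summit.BirchSwinnertonDyer.BirchSwinnertonDyer.Theses.UniversalToricDescent.TwinSplitIMCAtThreeMult := by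
  intro W' _ _ N' _ K _ _ Dt' hmult hsurj hN' hK hH hodd κ hκ γ _ 𝔭 h𝔭 he hf 𝔭' h𝔭' hne ι' hι'
  have hH1 := hHow W' N' K Dt' hmult hsurj hN' hK hH hodd κ hκ γ 𝔭 h𝔭 he hf 𝔭' h𝔭' hne ι' hι'
  have hMu : ∃ (ΩK : ℂ) (Ωp : ℂ_[3]) (L : UnrSeries 3), ΩK ≠ 0 ∧ Ωp ≠ 0 ∧
      IsBDPLFunction ι' 𝔭 κ γ Dt'.f ΩK Ωp L ∧ ∃ i : ℕ, IsUnit (PowerSeries.coeff i L) := by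
    obtain ⟨ΩK, Ωp, L, hΩK, hΩp, hL, -⟩ := hH1
    exact exists_muFrame_of_exists_frame_of_thmB hB W' N' K Dt' hsurj hK hH κ hκ γ 𝔭 h𝔭 he hf ι' hι'
      ⟨ΩK, Ωp, L, hΩK, hΩp, hL⟩
  exact UniversalToricDescentTwinSplit.twinSplit_instance_of_three_frames W' N' K Dt' κ γ 𝔭 𝔭' ι' hK hκ hH1
    (hWan W' N' K Dt' hmult hsurj hN' hK hH hodd κ hκ γ 𝔭 h𝔭 he hf 𝔭' h𝔭' hne ι' hι') hMu

end Summit.BirchSwinnertonDyer.BirchSwinnertonDyer.Theorems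

end
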